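import Summits.CriticalPhenomena.PercolationContinuityZ3.Theorems.PercNearOneGluingNoHeavyLowerTailHubPairTerm
import Summits.CriticalPhenomena.PercolationContinuityZ3.Theorems.PercNearOneGluingNoHeavyLowerTailHubPairTermEvents
import HarnessLib

/-!
# `NoHeavyLowerTail` (stmt-CriticalPhenomena-4575) — HUB PAIRS WITH A TERMINAL ALONE ON ITS SIDE, part 3:
# the replacement property of the four R1 cells in the eight arm states (near-side events)

Support file (prover prim-gen-kcluster gen 72; `--supports stmt-CriticalPhenomena-4575`).  Pure graph combinatorics (part 1) in event form: no measures,
no definitions, no named facts, no sorries.  Notation of parts 1–2; near-side atoms of a configuration `η ⊆ DK` (or `η⁺ = insert h₀h₁ η` in the joined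
states): `B = [b ∈ C_η(a)]`, `H_i = [h_i ∈ C_η(a)]`, `S_i = Sep DK (C_η(a)) b h_i` (`b` does not reach `h_i` in `DK` off `C_η(a)`).  For each arm state
the glued cells `T, U_b, U_c, S` of `(a; b, c)` are the near-side events (`rep_A … rep_H`):
`A`: `B∧H₀ | B∧¬H₀ | ¬B∧H₀ | ¬B∧¬H₀∧S₀∧S₁` (at `η⁺`);  `B`: `∅ | B | ∅ | ¬B∧(H₀∨S₀)∧(H₁∨S₁)` (at `η⁺`);  `C`: `B∧H₀ | B∧¬H₀ | ¬B∧H₀ | ¬B∧¬H₀∧S₀∧(H₁∨S₁)`;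
`D`: the mirror;  `E`: `∅ | B | ∅ | ¬B∧(H₀∨S₀)∧(H₁∨S₁)`;  `F` (`N₀`): last factor `H₁∨S₁∨H₀`;  `G` (`N₁`): middle factor `H₀∨S₀∨H₁`;  `H`: both.
These are gen 65 §11's near-side vectors `v*`, `v(h|01)`, `v(−|01)` (+ `J_h`) as events (KCLUSTER-gen72 §0).
-/

namespace Summit.CriticalPhenomena.PercolationContinuityZ3.Theorems

namespace HubPairTerm

open SimpleGraph Finset Literature.Probability.Percolation Literature.Probability.Percolation.Gladkov
open Literature.Probability.LatticeModels RefinedRowR3 ThreePointLB APL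
open scoped Classical

variable {V : Type*} [Fintype V]

section Cells

variable {DX DK : Finset (Sym2 V)} {a b c h₀ h₁ : V} (h01 : h₀ ≠ h₁) (hb0 : b ≠ h₀) (hb1 : b ≠ h₁) (hc0 : c ≠ h₀) (hc1 : c ≠ h₁)
  (hbc : b ≠ c) (hca : c ≠ a)
  (hsepD : ∀ t : V, (∃ e ∈ DX, t ∈ e) → (∃ e ∈ DK, t ∈ e) → (t = h₀ ∨ t = h₁))
  (haX : ∀ e ∈ DX, a ∉ e) (hbX : ∀ e ∈ DX, b ∉ e) (hcK : ∀ e ∈ DK, c ∉ e)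
  (hcX0 : c ∈ cl DX h₀) (hcX1 : c ∈ cl DX h₁)

include h01 in
/-- With the pair `h₀h₁` inserted, the two hubs lie in `C(a)` together. [folklore] -/
theorem hubs_iff_insert (κ : BondConfig V) :
    insert s(h₀, h₁) κ ∈ {η : BondConfig V | h₀ ∈ cl η.toFinset a} ↔ insert s(h₀, h₁) κ ∈ {η : BondConfig V | h₁ ∈ cl η.toFinset a} := by
  simp only [Set.mem_setOf_eq]
  suffices key : ∀ ζ : Finset (Sym2 V), (∀ e, e ∈ ζ ↔ e ∈ insert s(h₀, h₁) κ) → (h₀ ∈ cl ζ a ↔ h₁ ∈ cl ζ a) from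
    key _ (fun e => by simp only [Set.mem_toFinset])
  intro ζ hζ
  have hadj : (openGraph (↑ζ : Set (Sym2 V))).Adj h₀ h₁ := by
    rw [openGraph_adj, Finset.mem_coe, hζ]; exact ⟨Set.mem_insert _ _, h01⟩
  exact ⟨fun h => mem_cl_of_adj h hadj, fun h => mem_cl_of_adj h hadj.symm⟩

omit [Fintype V] in
/-- In state `C` the flag `N₁` fails (event form). [this work] -/
theorem not_flag_C [Fintype V] {ω : BondConfig V}
    (hS : (ω ∩ ↑DX) ∈ {η : BondConfig V | c ∈ cl η.toFinset h₀ ∧ h₁ ∉ cl η.toFinset h₀}) :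
    (ω ∩ ↑DX) ∉ {η : BondConfig V | Sep DX (cl η.toFinset h₁) c h₀} := by
  simp only [Set.mem_setOf_eq] at hS ⊢
  suffices key : ∀ ζ : Finset (Sym2 V), (∀ e, e ∈ ζ ↔ e ∈ ω ∩ (↑DX : Set (Sym2 V))) → c ∈ cl ζ h₀ → h₁ ∉ cl ζ h₀ →
      ¬ Sep DX (cl ζ h₁) c h₀ from key _ (fun e => by simp only [Set.mem_toFinset]) hS.1 hS.2
  intro ζ hζ hc h1
  exact not_flag_of_joined (fun e he => ((hζ e).1 he).2) hc h1

omit [Fintype V] in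
/-- In state `D` the flag `N₀` fails (event form). [this work] -/
theorem not_flag_D [Fintype V] {ω : BondConfig V}
    (hS : (ω ∩ ↑DX) ∈ {η : BondConfig V | c ∉ cl η.toFinset h₀ ∧ h₁ ∉ cl η.toFinset h₀ ∧ h₁ ∈ cl η.toFinset c}) :
    (ω ∩ ↑DX) ∉ {η : BondConfig V | Sep DX (cl η.toFinset h₀) c h₁} := by
  simp only [Set.mem_setOf_eq] at hS ⊢
  suffices key : ∀ ζ : Finset (Sym2 V), (∀ e, e ∈ ζ ↔ e ∈ ω ∩ (↑DX : Set (Sym2 V))) → h₁ ∉ cl ζ h₀ → h₁ ∈ cl ζ c →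
      ¬ Sep DX (cl ζ h₀) c h₁ from key _ (fun e => by simp only [Set.mem_toFinset]) hS.2.1 hS.2.2
  intro ζ hζ h1 hc
  exact not_flag_of_joined (fun e he => ((hζ e).1 he).2) (mem_cl_comm.1 hc) (fun h => h1 (mem_cl_comm.1 h))

include h01 hb0 hb1 hc0 hc1 hbc hca hsepD haX hbX hcK hcX0 hcX1

set_option linter.unusedSimpArgs false in
/-- **Replacement property, state `A`.** [this work] -/
theorem rep_A {ω : BondConfig V} (hω : ω ⊆ ↑DX ∪ ↑DK) (hS : (ω ∩ ↑DX) ∈ {η : BondConfig V | c ∈ cl η.toFinset h₀ ∧ h₁ ∈ cl η.toFinset h₀}) :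
    (ω ∈ {η : BondConfig V | b ∈ cl η.toFinset a ∧ c ∈ cl η.toFinset a} ↔ insert s(h₀, h₁) (ω \ ↑DX) ∈ {η : BondConfig V | b ∈ cl η.toFinset a ∧ h₀ ∈ cl η.toFinset a}) ∧ (ω ∈ {η : BondConfig V | b ∈ cl η.toFinset a ∧ c ∉ cl η.toFinset a} ↔ insert s(h₀, h₁) (ω \ ↑DX) ∈ {η : BondConfig V | b ∈ cl η.toFinset a ∧ h₀ ∉ cl η.toFinset a}) ∧
      (ω ∈ {η : BondConfig V | b ∉ cl η.toFinset a ∧ c ∈ cl η.toFinset a} ↔ insert s(h₀, h₁) (ω \ ↑DX) ∈ {η : BondConfig V | b ∉ cl η.toFinset a ∧ h₀ ∈ cl η.toFinset a}) ∧ (ω ∈ {η : BondConfig V | b ∉ cl η.toFinset a ∧ c ∉ cl η.toFinset a ∧ Sep (DX ∪ DK) (cl η.toFinset a) b c} ↔ insert s(h₀, h₁) (ω \ ↑DX) ∈ {η : BondConfig V | b ∉ cl η.toFinset a ∧ h₀ ∉ cl η.toFinset a ∧ Sep DK (cl η.toFinset a) b h₀ ∧ Sep DK (cl η.toFinset a)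 b h₁}) := by
  have hJ : (ω ∩ ↑DX) ∈ {η : BondConfig V | h₁ ∈ cl η.toFinset h₀} := hS.2
  have cx0 : (ω ∩ ↑DX) ∈ {η : BondConfig V | c ∈ cl η.toFinset h₀} := hS.1
  have cx1 : (ω ∩ ↑DX) ∈ {η : BondConfig V | c ∈ cl η.toFinset h₁} := mem_cl_trans (mem_cl_comm.1 hS.2) hS.1
  have eb := NetworkFold.mem_cl_iff_of_J h01 hsepD (x := a) (y := b) (fun e he hae => absurd hae (haX e he)) (fun e he hbe => absurd hbe (hbX e he)) hω hJ
  have e0 := NetworkFold.mem_cl_iff_of_J h01 hsepD (x := a) (y := h₀) (fun e he hae => absurd hae (haX e he)) (fun _ _ _ => Or.inl rfl) hω hJ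
  have e1 := NetworkFold.mem_cl_iff_of_J h01 hsepD (x := a) (y := h₁) (fun e he hae => absurd hae (haX e he)) (fun _ _ _ => Or.inr rfl) hω hJ
  have ec := c_mem_cl_iff hca hsepD haX hcK hω
  have es := sep_iff_master h01 hb0 hb1 hc0 hc1 hbc hsepD haX hbX hcK hcX0 hcX1 hω
  have r0 := reachK_iff_of_J (b := b) (h := h₀) h01 hsepD haX hω hJ
  have r1 := reachK_iff_of_J (b := b) (h := h₁) h01 hsepD haX hω hJ
  have hh := hubs_iff_insert (a := a) h01 (ω \ ↑DX)
  simp only [Set.mem_setOf_eq] at eb e0 e1 ec es r0 r1 cx0 cx1 hh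
  simp only [Set.mem_setOf_eq]
  rw [es, r0, r1, ec, eb, e0, e1]
  simp only [not_not]
  clear es r0 r1 ec eb e0 e1 hS hω hcX0 hcX1 hcK hbX haX hsepD
  refine ⟨?_, ?_, ?_, ?_⟩ <;> (try simp only [cx0, cx1, hh, true_and, and_true, false_and, and_false, or_false, false_or, true_or, or_true, not_true_eq_false, not_false_eq_true, and_self, or_self, not_or, not_and, not_not])
  tauto

set_option linter.unusedSimpArgs false in
/-- **Replacement property, state `B`.** [this work] -/
theorem rep_B {ω : BondConfig V} (hω : ω ⊆ ↑DX ∪ ↑DK) (hS : (ω ∩ ↑DX) ∈ {η : BondConfig V | c ∉ cl η.toFinset h₀ ∧ h₁ ∈ cl η.toFinset h₀}) :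
    (ω ∈ {η : BondConfig V | b ∈ cl η.toFinset a ∧ c ∈ cl η.toFinset a} ↔ insert s(h₀, h₁) (ω \ ↑DX) ∈ (∅ : Set (BondConfig V))) ∧ (ω ∈ {η : BondConfig V | b ∈ cl η.toFinset a ∧ c ∉ cl η.toFinset a} ↔ insert s(h₀, h₁) (ω \ ↑DX) ∈ {η : BondConfig V | b ∈ cl η.toFinset a}) ∧
      (ω ∈ {η : BondConfig V | b ∉ cl η.toFinset a ∧ c ∈ cl η.toFinset a} ↔ insert s(h₀, h₁) (ω \ ↑DX) ∈ (∅ : Set (BondConfig V))) ∧ (ω ∈ {η : BondConfig V | b ∉ cl η.toFinset a ∧ c ∉ cl η.toFinset a ∧ Sep (DX ∪ DK) (cl η.toFinset a) b c} ↔ insert s(h₀, h₁) (ω \ ↑DX) ∈ {η : BondConfig V | b ∉ cl η.toFinset a ∧ (h₀ ∈ cl η.toFinset a ∨ Sep DK (cl η.toFinset a) b h₀) ∧ (h₁ ∈ cl η.toFinset a ∨ Sep DK (cl η.toFinset a) b h₁)}) := by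
  have hJ : (ω ∩ ↑DX) ∈ {η : BondConfig V | h₁ ∈ cl η.toFinset h₀} := hS.2
  have cx0 : (ω ∩ ↑DX) ∉ {η : BondConfig V | c ∈ cl η.toFinset h₀} := hS.1
  have cx1 : (ω ∩ ↑DX) ∉ {η : BondConfig V | c ∈ cl η.toFinset h₁} := fun h => hS.1 (mem_cl_trans hS.2 (mem_cl_comm.1 (mem_cl_comm.1 h)))
  have eb := NetworkFold.mem_cl_iff_of_J h01 hsepD (x := a) (y := b) (fun e he hae => absurd hae (haX e he)) (fun e he hbe => absurd hbe (hbX e he)) hω hJ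
  have e0 := NetworkFold.mem_cl_iff_of_J h01 hsepD (x := a) (y := h₀) (fun e he hae => absurd hae (haX e he)) (fun _ _ _ => Or.inl rfl) hω hJ
  have e1 := NetworkFold.mem_cl_iff_of_J h01 hsepD (x := a) (y := h₁) (fun e he hae => absurd hae (haX e he)) (fun _ _ _ => Or.inr rfl) hω hJ
  have ec := c_mem_cl_iff hca hsepD haX hcK hω
  have es := sep_iff_master h01 hb0 hb1 hc0 hc1 hbc hsepD haX hbX hcK hcX0 hcX1 hω
  have r0 := reachK_iff_of_J (b := b) (h := h₀) h01 hsepD haX hω hJ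
  have r1 := reachK_iff_of_J (b := b) (h := h₁) h01 hsepD haX hω hJ
  have hh := hubs_iff_insert (a := a) h01 (ω \ ↑DX)
  simp only [Set.mem_setOf_eq] at eb e0 e1 ec es r0 r1 cx0 cx1 hh
  simp only [Set.mem_setOf_eq, Set.mem_empty_iff_false]
  rw [es, r0, r1, ec, eb, e0, e1]
  simp only [not_not]
  clear es r0 r1 ec eb e0 e1 hS hω hcX0 hcX1 hcK hbX haX hsepD
  refine ⟨?_, ?_, ?_, ?_⟩ <;> (try simp only [cx0, cx1, hh, true_and, and_true, false_and, and_false, or_false, false_or, true_or, or_true, not_true_eq_false, not_false_eq_true, and_self, or_self, not_or, not_and, not_not])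
  constructor
  · rintro ⟨hb, h1, h2⟩
    exact ⟨hb, h1.elim Or.inl (fun h => h.elim Or.inr (fun h' => Or.inl h'.1)),
      h2.elim Or.inl (fun h => h.elim Or.inr (fun h' => Or.inl h'.1))⟩
  · rintro ⟨hb, h1, h2⟩
    exact ⟨hb, h1.elim Or.inl (fun h => Or.inr (Or.inl h)), h2.elim Or.inl (fun h => Or.inr (Or.inl h))⟩

set_option linter.unusedSimpArgs false in
/-- **Replacement property, state `C`.** [this work] -/
theorem rep_C {ω : BondConfig V} (hω : ω ⊆ ↑DX ∪ ↑DK) (hS : (ω ∩ ↑DX) ∈ {η : BondConfig V | c ∈ cl η.toFinset h₀ ∧ h₁ ∉ cl η.toFinset h₀}) :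
    (ω ∈ {η : BondConfig V | b ∈ cl η.toFinset a ∧ c ∈ cl η.toFinset a} ↔ (ω \ ↑DX) ∈ {η : BondConfig V | b ∈ cl η.toFinset a ∧ h₀ ∈ cl η.toFinset a}) ∧ (ω ∈ {η : BondConfig V | b ∈ cl η.toFinset a ∧ c ∉ cl η.toFinset a} ↔ (ω \ ↑DX) ∈ {η : BondConfig V | b ∈ cl η.toFinset a ∧ h₀ ∉ cl η.toFinset a}) ∧
      (ω ∈ {η : BondConfig V | b ∉ cl η.toFinset a ∧ c ∈ cl η.toFinset a} ↔ (ω \ ↑DX) ∈ {η : BondConfig V | b ∉ cl η.toFinset a ∧ h₀ ∈ cl η.toFinset a}) ∧ (ω ∈ {η : BondConfig V | b ∉ cl η.toFinset a ∧ c ∉ cl η.toFinset a ∧ Sep (DX ∪ DK) (cl η.toFinset a) b c} ↔ (ω \ ↑DX) ∈ {η : BondConfig V | b ∉ cl η.toFinset a ∧ h₀ ∉ cl η.toFinset a ∧ Sep DK (cl η.toFinset a) b h₀ ∧ (h₁ ∈ cl η.toFinset a ∨ Sep DK (cl η.toFinset a) b h₁)}) := by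
  have hJ : (ω ∩ ↑DX) ∉ {η : BondConfig V | h₁ ∈ cl η.toFinset h₀} := hS.2
  have cx0 : (ω ∩ ↑DX) ∈ {η : BondConfig V | c ∈ cl η.toFinset h₀} := hS.1
  have cx1 : (ω ∩ ↑DX) ∉ {η : BondConfig V | c ∈ cl η.toFinset h₁} := fun h => hS.2 (mem_cl_trans hS.1 (mem_cl_comm.1 h))
  have nf1 : (ω ∩ ↑DX) ∉ {η : BondConfig V | Sep DX (cl η.toFinset h₁) c h₀} := not_flag_C (DX := DX) hS
  have eb := NetworkFold.mem_cl_iff_of_not_J h01 hsepD (x := a) (y := b) (fun e he hae => absurd hae (haX e he)) (fun e he hbe => absurd hbe (hbX e he)) hω hJ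
  have e0 := NetworkFold.mem_cl_iff_of_not_J h01 hsepD (x := a) (y := h₀) (fun e he hae => absurd hae (haX e he)) (fun _ _ _ => Or.inl rfl) hω hJ
  have e1 := NetworkFold.mem_cl_iff_of_not_J h01 hsepD (x := a) (y := h₁) (fun e he hae => absurd hae (haX e he)) (fun _ _ _ => Or.inr rfl) hω hJ
  have ec := c_mem_cl_iff hca hsepD haX hcK hω
  have es := sep_iff_master h01 hb0 hb1 hc0 hc1 hbc hsepD haX hbX hcK hcX0 hcX1 hω
  have r0 := reachK_iff_of_not_J (b := b) (h := h₀) h01 hsepD haX hω hJ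
  have r1 := reachK_iff_of_not_J (b := b) (h := h₁) h01 hsepD haX hω hJ
  simp only [Set.mem_setOf_eq] at eb e0 e1 ec es r0 r1 cx0 cx1 nf1
  simp only [Set.mem_setOf_eq]
  rw [es, r0, r1, ec, eb, e0, e1]
  simp only [not_not]
  clear es r0 r1 ec eb e0 e1 hS hω hcX0 hcX1 hcK hbX haX hsepD
  refine ⟨?_, ?_, ?_, ?_⟩ <;> (try simp only [cx0, cx1, nf1, true_and, and_true, false_and, and_false, or_false, false_or, true_or, or_true, not_true_eq_false, not_false_eq_true, and_self, or_self, not_or, not_and, not_not])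
  constructor
  · rintro ⟨hb, h0, h1, h2⟩
    exact ⟨hb, h0, h1.resolve_left h0, h2.elim Or.inl (fun h => h.elim Or.inr (fun h' => absurd h'.1 h0))⟩
  · rintro ⟨hb, h0, h1, h2⟩
    exact ⟨hb, h0, Or.inr h1, h2.elim Or.inl (fun h => Or.inr (Or.inl h))⟩

set_option linter.unusedSimpArgs false in
/-- **Replacement property, state `D`.** [this work] -/
theorem rep_D {ω : BondConfig V} (hω : ω ⊆ ↑DX ∪ ↑DK) (hS : (ω ∩ ↑DX) ∈ {η : BondConfig V | c ∉ cl η.toFinset h₀ ∧ h₁ ∉ cl η.toFinset h₀ ∧ h₁ ∈ cl η.toFinset c}) :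
    (ω ∈ {η : BondConfig V | b ∈ cl η.toFinset a ∧ c ∈ cl η.toFinset a} ↔ (ω \ ↑DX) ∈ {η : BondConfig V | b ∈ cl η.toFinset a ∧ h₁ ∈ cl η.toFinset a}) ∧ (ω ∈ {η : BondConfig V | b ∈ cl η.toFinset a ∧ c ∉ cl η.toFinset a} ↔ (ω \ ↑DX) ∈ {η : BondConfig V | b ∈ cl η.toFinset a ∧ h₁ ∉ cl η.toFinset a}) ∧
      (ω ∈ {η : BondConfig V | b ∉ cl η.toFinset a ∧ c ∈ cl η.toFinset a} ↔ (ω \ ↑DX) ∈ {η : BondConfig V | b ∉ cl η.toFinset a ∧ h₁ ∈ cl η.toFinset a}) ∧ (ω ∈ {η : BondConfig V | b ∉ cl η.toFinset a ∧ c ∉ cl η.toFinset a ∧ Sep (DX ∪ DK) (cl η.toFinset a) b c} ↔ (ω \ ↑DX) ∈ {η : BondConfig V | b ∉ cl η.toFinset a ∧ h₁ ∉ cl η.toFinset a ∧ Sep DK (cl η.toFinset a) b h₁ ∧ (h₀ ∈ cl η.toFinset a ∨ Sep DK (cl η.toFinset a) b h₀)}) := by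
  have hJ : (ω ∩ ↑DX) ∉ {η : BondConfig V | h₁ ∈ cl η.toFinset h₀} := hS.2.1
  have cx0 : (ω ∩ ↑DX) ∉ {η : BondConfig V | c ∈ cl η.toFinset h₀} := hS.1
  have cx1 : (ω ∩ ↑DX) ∈ {η : BondConfig V | c ∈ cl η.toFinset h₁} := mem_cl_comm.1 hS.2.2
  have nf0 : (ω ∩ ↑DX) ∉ {η : BondConfig V | Sep DX (cl η.toFinset h₀) c h₁} := not_flag_D (DX := DX) hS
  have eb := NetworkFold.mem_cl_iff_of_not_J h01 hsepD (x := a) (y := b) (fun e he hae => absurd hae (haX e he)) (fun e he hbe => absurd hbe (hbX e he)) hω hJ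
  have e0 := NetworkFold.mem_cl_iff_of_not_J h01 hsepD (x := a) (y := h₀) (fun e he hae => absurd hae (haX e he)) (fun _ _ _ => Or.inl rfl) hω hJ
  have e1 := NetworkFold.mem_cl_iff_of_not_J h01 hsepD (x := a) (y := h₁) (fun e he hae => absurd hae (haX e he)) (fun _ _ _ => Or.inr rfl) hω hJ
  have ec := c_mem_cl_iff hca hsepD haX hcK hω
  have es := sep_iff_master h01 hb0 hb1 hc0 hc1 hbc hsepD haX hbX hcK hcX0 hcX1 hω
  have r0 := reachK_iff_of_not_J (b := b) (h := h₀) h01 hsepD haX hω hJ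
  have r1 := reachK_iff_of_not_J (b := b) (h := h₁) h01 hsepD haX hω hJ
  simp only [Set.mem_setOf_eq] at eb e0 e1 ec es r0 r1 cx0 cx1 nf0
  simp only [Set.mem_setOf_eq]
  rw [es, r0, r1, ec, eb, e0, e1]
  simp only [not_not]
  clear es r0 r1 ec eb e0 e1 hS hω hcX0 hcX1 hcK hbX haX hsepD
  refine ⟨?_, ?_, ?_, ?_⟩ <;> (try simp only [cx0, cx1, nf0, true_and, and_true, false_and, and_false, or_false, false_or, true_or, or_true, not_true_eq_false, not_false_eq_true, and_self, or_self, not_or, not_and, not_not])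
  constructor
  · rintro ⟨hb, h1, h2, h3⟩
    exact ⟨hb, h1, h3.resolve_left h1, h2.elim Or.inl (fun h => h.elim Or.inr (fun h' => absurd h'.1 h1))⟩
  · rintro ⟨hb, h1, h2, h3⟩
    exact ⟨hb, h1, h3.elim Or.inl (fun h => Or.inr (Or.inl h)), Or.inr h2⟩

set_option linter.unusedSimpArgs false in
/-- **Replacement property, state `E`.** [this work] -/
theorem rep_E {ω : BondConfig V} (hω : ω ⊆ ↑DX ∪ ↑DK) (hS : (ω ∩ ↑DX) ∈ {η : BondConfig V | c ∉ cl η.toFinset h₀ ∧ h₁ ∉ cl η.toFinset h₀ ∧ h₁ ∉ cl η.toFinset c ∧ ¬ Sep DX (cl η.toFinset h₀) c h₁ ∧ ¬ Sep DX (cl η.toFinset h₁) c h₀}) :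
    (ω ∈ {η : BondConfig V | b ∈ cl η.toFinset a ∧ c ∈ cl η.toFinset a} ↔ (ω \ ↑DX) ∈ (∅ : Set (BondConfig V))) ∧ (ω ∈ {η : BondConfig V | b ∈ cl η.toFinset a ∧ c ∉ cl η.toFinset a} ↔ (ω \ ↑DX) ∈ {η : BondConfig V | b ∈ cl η.toFinset a}) ∧
      (ω ∈ {η : BondConfig V | b ∉ cl η.toFinset a ∧ c ∈ cl η.toFinset a} ↔ (ω \ ↑DX) ∈ (∅ : Set (BondConfig V))) ∧ (ω ∈ {η : BondConfig V | b ∉ cl η.toFinset a ∧ c ∉ cl η.toFinset a ∧ Sep (DX ∪ DK) (cl η.toFinset a) b c} ↔ (ω \ ↑DX) ∈ {η : BondConfig V | b ∉ cl η.toFinset a ∧ (h₀ ∈ cl η.toFinset a ∨ Sep DK (cl η.toFinset a) b h₀) ∧ (h₁ ∈ cl η.toFinset a ∨ Sep DK (cl η.toFinset a) b h₁)}) := by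
  have hJ : (ω ∩ ↑DX) ∉ {η : BondConfig V | h₁ ∈ cl η.toFinset h₀} := hS.2.1
  have cx0 : (ω ∩ ↑DX) ∉ {η : BondConfig V | c ∈ cl η.toFinset h₀} := hS.1
  have cx1 : (ω ∩ ↑DX) ∉ {η : BondConfig V | c ∈ cl η.toFinset h₁} := fun h => hS.2.2.1 (mem_cl_comm.1 h)
  have nf0 := hS.2.2.2.1
  have nf1 := hS.2.2.2.2
  have eb := NetworkFold.mem_cl_iff_of_not_J h01 hsepD (x := a) (y := b) (fun e he hae => absurd hae (haX e he)) (fun e he hbe => absurd hbe (hbX e he)) hω hJ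
  have e0 := NetworkFold.mem_cl_iff_of_not_J h01 hsepD (x := a) (y := h₀) (fun e he hae => absurd hae (haX e he)) (fun _ _ _ => Or.inl rfl) hω hJ
  have e1 := NetworkFold.mem_cl_iff_of_not_J h01 hsepD (x := a) (y := h₁) (fun e he hae => absurd hae (haX e he)) (fun _ _ _ => Or.inr rfl) hω hJ
  have ec := c_mem_cl_iff hca hsepD haX hcK hω
  have es := sep_iff_master h01 hb0 hb1 hc0 hc1 hbc hsepD haX hbX hcK hcX0 hcX1 hω
  have r0 := reachK_iff_of_not_J (b := b) (h := h₀) h01 hsepD haX hω hJ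
  have r1 := reachK_iff_of_not_J (b := b) (h := h₁) h01 hsepD haX hω hJ
  simp only [Set.mem_setOf_eq] at eb e0 e1 ec es r0 r1 cx0 cx1 nf0 nf1
  simp only [Set.mem_setOf_eq, Set.mem_empty_iff_false]
  rw [es, r0, r1, ec, eb, e0, e1]
  simp only [not_not]
  clear es r0 r1 ec eb e0 e1 hS hω hcX0 hcX1 hcK hbX haX hsepD
  refine ⟨?_, ?_, ?_, ?_⟩ <;> (try simp only [cx0, cx1, nf0, nf1, true_and, and_true, false_and, and_false, or_false, false_or, true_or, or_true, not_true_eq_false, not_false_eq_true, and_self, or_self, not_or, not_and, not_not])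

set_option linter.unusedSimpArgs false in
/-- **Replacement property, state `F`.** [this work] -/
theorem rep_F {ω : BondConfig V} (hω : ω ⊆ ↑DX ∪ ↑DK) (hS : (ω ∩ ↑DX) ∈ {η : BondConfig V | c ∉ cl η.toFinset h₀ ∧ h₁ ∉ cl η.toFinset h₀ ∧ h₁ ∉ cl η.toFinset c ∧ Sep DX (cl η.toFinset h₀) c h₁ ∧ ¬ Sep DX (cl η.toFinset h₁) c h₀}) :
    (ω ∈ {η : BondConfig V | b ∈ cl η.toFinset a ∧ c ∈ cl η.toFinset a} ↔ (ω \ ↑DX) ∈ (∅ : Set (BondConfig V))) ∧ (ω ∈ {η : BondConfig V | b ∈ cl η.toFinset a ∧ c ∉ cl η.toFinset a} ↔ (ω \ ↑DX) ∈ {η : BondConfig V | b ∈ cl η.toFinset a}) ∧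
      (ω ∈ {η : BondConfig V | b ∉ cl η.toFinset a ∧ c ∈ cl η.toFinset a} ↔ (ω \ ↑DX) ∈ (∅ : Set (BondConfig V))) ∧ (ω ∈ {η : BondConfig V | b ∉ cl η.toFinset a ∧ c ∉ cl η.toFinset a ∧ Sep (DX ∪ DK) (cl η.toFinset a) b c} ↔ (ω \ ↑DX) ∈ {η : BondConfig V | b ∉ cl η.toFinset a ∧ (h₀ ∈ cl η.toFinset a ∨ Sep DK (cl η.toFinset a) b h₀) ∧ (h₁ ∈ cl η.toFinset a ∨ Sep DK (cl η.toFinset a) b h₁ ∨ h₀ ∈ cl η.toFinset a)}) := by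
  have hJ : (ω ∩ ↑DX) ∉ {η : BondConfig V | h₁ ∈ cl η.toFinset h₀} := hS.2.1
  have cx0 : (ω ∩ ↑DX) ∉ {η : BondConfig V | c ∈ cl η.toFinset h₀} := hS.1
  have cx1 : (ω ∩ ↑DX) ∉ {η : BondConfig V | c ∈ cl η.toFinset h₁} := fun h => hS.2.2.1 (mem_cl_comm.1 h)
  have nf0 := hS.2.2.2.1
  have nf1 := hS.2.2.2.2
  have eb := NetworkFold.mem_cl_iff_of_not_J h01 hsepD (x := a) (y := b) (fun e he hae => absurd hae (haX e he)) (fun e he hbe => absurd hbe (hbX e he)) hω hJ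
  have e0 := NetworkFold.mem_cl_iff_of_not_J h01 hsepD (x := a) (y := h₀) (fun e he hae => absurd hae (haX e he)) (fun _ _ _ => Or.inl rfl) hω hJ
  have e1 := NetworkFold.mem_cl_iff_of_not_J h01 hsepD (x := a) (y := h₁) (fun e he hae => absurd hae (haX e he)) (fun _ _ _ => Or.inr rfl) hω hJ
  have ec := c_mem_cl_iff hca hsepD haX hcK hω
  have es := sep_iff_master h01 hb0 hb1 hc0 hc1 hbc hsepD haX hbX hcK hcX0 hcX1 hω
  have r0 := reachK_iff_of_not_J (b := b) (h := h₀) h01 hsepD haX hω hJ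
  have r1 := reachK_iff_of_not_J (b := b) (h := h₁) h01 hsepD haX hω hJ
  simp only [Set.mem_setOf_eq] at eb e0 e1 ec es r0 r1 cx0 cx1 nf0 nf1
  simp only [Set.mem_setOf_eq, Set.mem_empty_iff_false]
  rw [es, r0, r1, ec, eb, e0, e1]
  simp only [not_not]
  clear es r0 r1 ec eb e0 e1 hS hω hcX0 hcX1 hcK hbX haX hsepD
  refine ⟨?_, ?_, ?_, ?_⟩ <;> (try simp only [cx0, cx1, nf0, nf1, true_and, and_true, false_and, and_false, or_false, false_or, true_or, or_true, not_true_eq_false, not_false_eq_true, and_self, or_self, not_or, not_and, not_not])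

set_option linter.unusedSimpArgs false in
/-- **Replacement property, state `G`.** [this work] -/
theorem rep_G {ω : BondConfig V} (hω : ω ⊆ ↑DX ∪ ↑DK) (hS : (ω ∩ ↑DX) ∈ {η : BondConfig V | c ∉ cl η.toFinset h₀ ∧ h₁ ∉ cl η.toFinset h₀ ∧ h₁ ∉ cl η.toFinset c ∧ ¬ Sep DX (cl η.toFinset h₀) c h₁ ∧ Sep DX (cl η.toFinset h₁) c h₀}) :
    (ω ∈ {η : BondConfig V | b ∈ cl η.toFinset a ∧ c ∈ cl η.toFinset a} ↔ (ω \ ↑DX) ∈ (∅ : Set (BondConfig V))) ∧ (ω ∈ {η : BondConfig V | b ∈ cl η.toFinset a ∧ c ∉ cl η.toFinset a} ↔ (ω \ ↑DX) ∈ {η : BondConfig V | b ∈ cl η.toFinset a}) ∧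
      (ω ∈ {η : BondConfig V | b ∉ cl η.toFinset a ∧ c ∈ cl η.toFinset a} ↔ (ω \ ↑DX) ∈ (∅ : Set (BondConfig V))) ∧ (ω ∈ {η : BondConfig V | b ∉ cl η.toFinset a ∧ c ∉ cl η.toFinset a ∧ Sep (DX ∪ DK) (cl η.toFinset a) b c} ↔ (ω \ ↑DX) ∈ {η : BondConfig V | b ∉ cl η.toFinset a ∧ (h₀ ∈ cl η.toFinset a ∨ Sep DK (cl η.toFinset a) b h₀ ∨ h₁ ∈ cl η.toFinset a) ∧ (h₁ ∈ cl η.toFinset a ∨ Sep DK (cl η.toFinset a) b h₁)}) := by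
  have hJ : (ω ∩ ↑DX) ∉ {η : BondConfig V | h₁ ∈ cl η.toFinset h₀} := hS.2.1
  have cx0 : (ω ∩ ↑DX) ∉ {η : BondConfig V | c ∈ cl η.toFinset h₀} := hS.1
  have cx1 : (ω ∩ ↑DX) ∉ {η : BondConfig V | c ∈ cl η.toFinset h₁} := fun h => hS.2.2.1 (mem_cl_comm.1 h)
  have nf0 := hS.2.2.2.1
  have nf1 := hS.2.2.2.2
  have eb := NetworkFold.mem_cl_iff_of_not_J h01 hsepD (x := a) (y := b) (fun e he hae => absurd hae (haX e he)) (fun e he hbe => absurd hbe (hbX e he)) hω hJ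
  have e0 := NetworkFold.mem_cl_iff_of_not_J h01 hsepD (x := a) (y := h₀) (fun e he hae => absurd hae (haX e he)) (fun _ _ _ => Or.inl rfl) hω hJ
  have e1 := NetworkFold.mem_cl_iff_of_not_J h01 hsepD (x := a) (y := h₁) (fun e he hae => absurd hae (haX e he)) (fun _ _ _ => Or.inr rfl) hω hJ
  have ec := c_mem_cl_iff hca hsepD haX hcK hω
  have es := sep_iff_master h01 hb0 hb1 hc0 hc1 hbc hsepD haX hbX hcK hcX0 hcX1 hω
  have r0 := reachK_iff_of_not_J (b := b) (h := h₀) h01 hsepD haX hω hJ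
  have r1 := reachK_iff_of_not_J (b := b) (h := h₁) h01 hsepD haX hω hJ
  simp only [Set.mem_setOf_eq] at eb e0 e1 ec es r0 r1 cx0 cx1 nf0 nf1
  simp only [Set.mem_setOf_eq, Set.mem_empty_iff_false]
  rw [es, r0, r1, ec, eb, e0, e1]
  simp only [not_not]
  clear es r0 r1 ec eb e0 e1 hS hω hcX0 hcX1 hcK hbX haX hsepD
  refine ⟨?_, ?_, ?_, ?_⟩ <;> (try simp only [cx0, cx1, nf0, nf1, true_and, and_true, false_and, and_false, or_false, false_or, true_or, or_true, not_true_eq_false, not_false_eq_true, and_self, or_self, not_or, not_and, not_not])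

set_option linter.unusedSimpArgs false in
/-- **Replacement property, state `H`.** [this work] -/
theorem rep_H {ω : BondConfig V} (hω : ω ⊆ ↑DX ∪ ↑DK) (hS : (ω ∩ ↑DX) ∈ {η : BondConfig V | c ∉ cl η.toFinset h₀ ∧ h₁ ∉ cl η.toFinset h₀ ∧ h₁ ∉ cl η.toFinset c ∧ Sep DX (cl η.toFinset h₀) c h₁ ∧ Sep DX (cl η.toFinset h₁) c h₀}) :
    (ω ∈ {η : BondConfig V | b ∈ cl η.toFinset a ∧ c ∈ cl η.toFinset a} ↔ (ω \ ↑DX) ∈ (∅ : Set (BondConfig V))) ∧ (ω ∈ {η : BondConfig V | b ∈ cl η.toFinset a ∧ c ∉ cl η.toFinset a} ↔ (ω \ ↑DX) ∈ {η : BondConfig V | b ∈ cl η.toFinset a}) ∧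
      (ω ∈ {η : BondConfig V | b ∉ cl η.toFinset a ∧ c ∈ cl η.toFinset a} ↔ (ω \ ↑DX) ∈ (∅ : Set (BondConfig V))) ∧ (ω ∈ {η : BondConfig V | b ∉ cl η.toFinset a ∧ c ∉ cl η.toFinset a ∧ Sep (DX ∪ DK) (cl η.toFinset a) b c} ↔ (ω \ ↑DX) ∈ {η : BondConfig V | b ∉ cl η.toFinset a ∧ (h₀ ∈ cl η.toFinset a ∨ Sep DK (cl η.toFinset a) b h₀ ∨ h₁ ∈ cl η.toFinset a) ∧ (h₁ ∈ cl η.toFinset a ∨ Sep DK (cl η.toFinset a) b h₁ ∨ h₀ ∈ cl η.toFinset a)}) := by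
  have hJ : (ω ∩ ↑DX) ∉ {η : BondConfig V | h₁ ∈ cl η.toFinset h₀} := hS.2.1
  have cx0 : (ω ∩ ↑DX) ∉ {η : BondConfig V | c ∈ cl η.toFinset h₀} := hS.1
  have cx1 : (ω ∩ ↑DX) ∉ {η : BondConfig V | c ∈ cl η.toFinset h₁} := fun h => hS.2.2.1 (mem_cl_comm.1 h)
  have nf0 := hS.2.2.2.1
  have nf1 := hS.2.2.2.2
  have eb := NetworkFold.mem_cl_iff_of_not_J h01 hsepD (x := a) (y := b) (fun e he hae => absurd hae (haX e he)) (fun e he hbe => absurd hbe (hbX e he)) hω hJ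
  have e0 := NetworkFold.mem_cl_iff_of_not_J h01 hsepD (x := a) (y := h₀) (fun e he hae => absurd hae (haX e he)) (fun _ _ _ => Or.inl rfl) hω hJ
  have e1 := NetworkFold.mem_cl_iff_of_not_J h01 hsepD (x := a) (y := h₁) (fun e he hae => absurd hae (haX e he)) (fun _ _ _ => Or.inr rfl) hω hJ
  have ec := c_mem_cl_iff hca hsepD haX hcK hω
  have es := sep_iff_master h01 hb0 hb1 hc0 hc1 hbc hsepD haX hbX hcK hcX0 hcX1 hω
  have r0 := reachK_iff_of_not_J (b := b) (h := h₀) h01 hsepD haX hω hJ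
  have r1 := reachK_iff_of_not_J (b := b) (h := h₁) h01 hsepD haX hω hJ
  simp only [Set.mem_setOf_eq] at eb e0 e1 ec es r0 r1 cx0 cx1 nf0 nf1
  simp only [Set.mem_setOf_eq, Set.mem_empty_iff_false]
  rw [es, r0, r1, ec, eb, e0, e1]
  simp only [not_not]
  clear es r0 r1 ec eb e0 e1 hS hω hcX0 hcX1 hcK hbX haX hsepD
  refine ⟨?_, ?_, ?_, ?_⟩ <;> (try simp only [cx0, cx1, nf0, nf1, true_and, and_true, false_and, and_false, or_false, false_or, true_or, or_true, not_true_eq_false, not_false_eq_true, and_self, or_self, not_or, not_and, not_not])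

end Cells

end HubPairTerm

end Summit.CriticalPhenomena.PercolationContinuityZ3.Theorems
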